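import Literature.Computability.AlgebraicComplexity.BI17FundamentalInvariantTensors
import Literature.Computability.AlgebraicComplexity.BI17MatMulStabilizerProofs
import Literature.FieldTheory.QuasiAlgClosed.Basic
import HarnessLib

/-!
# Bürgisser–Ikenmeyer 2017, Cor. 5.12 and Cor. 5.26 from Thm. 5.11 and Thm. 5.8 — PROOFS
# (conditional bridges), with the relabelling invariance of `a(w)`, polystability and `O(\overline{Gw})`

P. Bürgisser, C. Ikenmeyer, *Fundamental invariants of orbit closures*, J. Algebra **477** (2017)
390–434 = arXiv:1511.02927 [BurgisserIkenmeyer2017], §5.1–§5.2 (TeX `main.tex` L2216–2231,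
L2478–2500; held text `paper:arxiv-1511.02927` p0019, p0022). THEOREMS ONLY; sibling of the statement
file `BI17FundamentalInvariantTensors.lean` (val-lit row BI2017-B, file of record t04), in whose
vocabulary everything is stated; nothing is restated and no new named fact is introduced.

The paper derives Cor. 5.12 ("The following is immediate", L2224) and Cor. 5.26 ("Theorem 5.11
immediately implies the following", L2494) from Thm. 5.11 together with Thm. 5.8(3), `e(w) =
m a(w) e'(w)` (Lemma 5.1(3)), the generic period `a(m) = 1` for `m ≥ 3` (Thm. 4.2), generic
polystability (Prop. 4.10), `a(⟨m⟩) = 2` (Thm. 4.3) and `a(⟨n,n,n⟩) = 1` (Cor. 4.6). The deep inputs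
(Thm. 5.11, Thm. 5.8, Lemma 5.1(3), Thm. 4.2, Prop. 4.10) are named facts of the statement file; Thm.
4.3, Cor. 4.6 and Cor. 4.9 are proved in the tree (`BI2017_thm_4_3_holds`, `BI2017_cor_4_6_holds`,
`BI2017_cor_4_9_unitTensor_holds`, `BurgisserIkenmeyer2017_cor49_matMulTensor_holds`). This file
proves the two "immediate" deductions as conditional bridges:

* `BI2017_cor_5_12_of_facts : BI2017_thm_5_11 → BI2017_thm_5_8 → BI2017_lem_5_1_3 →
  BI2017_thm_4_2 → BI2017_prop_4_10 → BI2017_cor_5_12` (part 1 needs only the first three: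
  `BI2017_cor_5_12_part1_of_facts`);
* `BI2017_cor_5_26_of_cor_5_12 : BI2017_cor_5_12 → BI2017_cor_5_26`, hence
  `BI2017_cor_5_26_of_facts : BI2017_thm_5_11 → BI2017_thm_5_8 → BI2017_lem_5_1_3 → BI2017_cor_5_26`.

On the way (all proved, no hypotheses): the existence of the fundamental invariant `Φ_w` of
Def. 5.7 whenever `e(w) > 0` (`exists_isTensorFundamentalInvariant`: a homogeneous `SL³`-invariant
not vanishing on `Gw` does not vanish at `w`, since `GL³ = (ℂ^× · 1)·SL³` over `ℂ`), and the
invariance of the stabilizer period `a(w)`, of polystability and of the coordinate ring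
`O(\overline{Gw})` (up to ring isomorphism) under relabelling the three index sets along bijections
`eᵢ : ι ≃ κ` — used to pass between `⟨n,n,n⟩ ∈ ⊗³ℂ^{n×n}` (`biMatMulTensor`, the format of Cor. 4.6
and Cor. 5.26) and `⟨n,n,n⟩ ∈ ⊗³ℂ^{n²}` (`biMatMulTensorFin`, the format of Thm. 5.11 / Cor. 5.25),
and from the tree's `matMulTensor ℂ n n n` (Bläser's coordinates, Cor. 4.9) to `biMatMulTensor`.

Honest framing: typed-literature proofs for the cell `val-lit`; nothing here bears on VP versus VNP.

## References

* [BurgisserIkenmeyer2017] P. Bürgisser, C. Ikenmeyer, *Fundamental invariants of orbit closures*,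
  J. Algebra 477 (2017) 390–434; arXiv:1511.02927, Def. 5.7, Thm. 5.8, Thm. 5.11, Cor. 5.12,
  Cor. 5.26.
* P. Bürgisser, C. Ikenmeyer, *Geometric complexity theory and tensor rank*, STOC 2011 (Cor. 5.26
  first appeared there).
-/

noncomputable section

open MvPolynomial Matrix

namespace Literature.Computability.AlgebraicComplexity

/-! ### Scaling: `GL³ = (ℂ^× · 1) · SL³` and homogeneous `SL³`-invariants -/

section Scaling

variable {ι : Type*} [Fintype ι] [DecidableEq ι]

omit [DecidableEq ι] in
/-- `(aA ⊗ bB ⊗ cC)·t = (abc)·((A ⊗ B ⊗ C)·t)`. [folklore] -/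
private theorem actTensor_smul_smul_smul (a b c : ℂ) (A B C : Matrix ι ι ℂ) (t : ι → ι → ι → ℂ) :
    actTensor (a • A) (b • B) (c • C) t = (a * b * c) • actTensor A B C t := by
  funext x y z
  simp only [actTensor_apply, Pi.smul_apply, Matrix.smul_apply, smul_eq_mul, Finset.mul_sum]
  refine Finset.sum_congr rfl fun _ _ => Finset.sum_congr rfl fun _ _ =>
    Finset.sum_congr rfl fun _ _ => by ring

omit [Fintype ι] [DecidableEq ι] in
/-- Coordinates of a scaled tensor: `tensorPt (c • v) = c • tensorPt v`. [folklore] -/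
private theorem tensorPt_smul (c : ℂ) (v : ι → ι → ι → ℂ) : tensorPt (c • v) = c • tensorPt v := rfl

omit [Fintype ι] [DecidableEq ι] in
/-- A form of degree `d` on `⊗³ℂ^ι` satisfies `F(c v) = c^d F(v)`. [folklore] -/
private theorem aeval_tensorPt_smul {F : MvPolynomial (ι × ι × ι) ℂ} {d : ℕ} (hF : F.IsHomogeneous d)
    (c : ℂ) (v : ι → ι → ι → ℂ) :
    aeval (tensorPt (c • v)) F = c ^ d * aeval (tensorPt v) F := by
  rw [tensorPt_smul]
  simp only [MvPolynomial.aeval_eq_eval]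
  exact hF.eval_smul_eq c (tensorPt v)

/-- An `SL³`-invariant form `F` of degree `d` is a `GL³`-semi-invariant: for `g ∈ GL³(ℂ)`,
`F(g·w) = c F(w)` with `c ≠ 0` (`c = (t₁t₂t₃)^d` for roots `tᵢ^m = det gᵢ`, writing
`gᵢ = tᵢ sᵢ` with `sᵢ ∈ SL`; cf. the map `ι(t) = (t·id, id, id)` in the proof of Lemma 5.1).
[cite: BurgisserIkenmeyer2017, Lemma 5.1 (proof)] -/
theorem exists_aeval_tensorPt_actTensor_eq_mul {F : MvPolynomial (ι × ι × ι) ℂ} {d : ℕ}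
    (hF : F.IsHomogeneous d) (hinv : IsSL3Invariant F) (g : GL ι ℂ × GL ι ℂ × GL ι ℂ)
    (w : ι → ι → ι → ℂ) :
    ∃ c : ℂ, c ≠ 0 ∧
      aeval (tensorPt (actTensor (g.1 : Matrix ι ι ℂ) (g.2.1 : Matrix ι ι ℂ) (g.2.2 : Matrix ι ι ℂ)
        w)) F = c * aeval (tensorPt w) F := by
  rcases isEmpty_or_nonempty ι with hι | hι
  · exact ⟨1, one_ne_zero, by rw [one_mul, Subsingleton.elim (actTensor _ _ _ w) w]⟩
  have hm : 0 < Fintype.card ι := Fintype.card_pos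
  -- an `m`-th root `t` of `det g` with `g = t • s`, `det s = 1`
  have root : ∀ u : GL ι ℂ, ∃ (t : ℂ) (s : Matrix.SpecialLinearGroup ι ℂ),
      t ≠ 0 ∧ (u : Matrix ι ι ℂ) = t • (s : Matrix ι ι ℂ) := by
    intro u
    have hdet : (u : Matrix ι ι ℂ).det ≠ 0 := by
      rw [← Matrix.GeneralLinearGroup.val_det_apply]; exact Units.ne_zero _
    obtain ⟨t, ht⟩ := IsAlgClosed.exists_pow_nat_eq (u : Matrix ι ι ℂ).det hm
    have ht0 : t ≠ 0 := by
      rintro rfl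
      rw [zero_pow hm.ne'] at ht
      exact hdet ht.symm
    refine ⟨t, ⟨t⁻¹ • (u : Matrix ι ι ℂ), ?_⟩, ht0, ?_⟩
    · rw [Matrix.det_smul, ← ht, inv_pow, inv_mul_cancel₀ (pow_ne_zero _ ht0)]
    · change (u : Matrix ι ι ℂ) = t • (t⁻¹ • (u : Matrix ι ι ℂ))
      rw [smul_smul, mul_inv_cancel₀ ht0, one_smul]
  obtain ⟨t₁, s₁, h₁, hg₁⟩ := root g.1
  obtain ⟨t₂, s₂, h₂, hg₂⟩ := root g.2.1
  obtain ⟨t₃, s₃, h₃, hg₃⟩ := root g.2.2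
  refine ⟨(t₁ * t₂ * t₃) ^ d, pow_ne_zero _ (mul_ne_zero (mul_ne_zero h₁ h₂) h₃), ?_⟩
  rw [hg₁, hg₂, hg₃, actTensor_smul_smul_smul, aeval_tensorPt_smul hF, hinv s₁ s₂ s₃ w]

/-- A homogeneous `SL³`-invariant which does not vanish identically on the orbit `Gw` does not
vanish at `w` itself. [cite: BurgisserIkenmeyer2017, Lemma 5.1 (proof)] -/
theorem aeval_tensorPt_ne_zero_of_not_mem_tensorOrbitVanishingIdeal
    {F : MvPolynomial (ι × ι × ι) ℂ} {d : ℕ} (hF : F.IsHomogeneous d) (hinv : IsSL3Invariant F)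
    {w : ι → ι → ι → ℂ} (hI : F ∉ tensorOrbitVanishingIdeal w) : aeval (tensorPt w) F ≠ 0 := by
  intro h0
  apply hI
  rw [tensorOrbitVanishingIdeal, MvPolynomial.mem_vanishingIdeal_iff]
  rintro _ ⟨v, ⟨g, rfl⟩, rfl⟩
  obtain ⟨c, -, hc⟩ := exists_aeval_tensorPt_actTensor_eq_mul hF hinv g w
  rw [hc, h0, mul_zero]

/-- **Existence of the fundamental invariant `Φ_w`** (Def. 5.7: "the `SL^3_m`-invariant `Φ_w` in
`O(\overline{Gw})` of the (minimal) degree `e(w)` satisfying `Φ_w(w) = 1`") as soon as the degree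
monoid `E(w)` has a positive element, i.e. `e(w) > 0`: a degree-`e(w)` homogeneous `SL³`-invariant
`F ∉ I(Gw)` has `F(w) ≠ 0`, and `Φ_w := F(w)⁻¹ F`. [cite: BurgisserIkenmeyer2017, Def. 5.7] -/
theorem exists_isTensorFundamentalInvariant (w : ι → ι → ι → ℂ)
    (he : 0 < tensorMinimalDegree w) : ∃ Φ, IsTensorFundamentalInvariant w Φ := by
  have hmem : tensorMinimalDegree w ∈ {d | d ∈ tensorDegreeMonoid w ∧ 0 < d} :=
    Nat.sInf_mem (Nat.nonempty_of_pos_sInf he)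
  obtain ⟨⟨F, hFh, hFi, hFI⟩, -⟩ := hmem
  have hFw := aeval_tensorPt_ne_zero_of_not_mem_tensorOrbitVanishingIdeal hFh hFi hFI
  refine ⟨C (aeval (tensorPt w) F)⁻¹ * F, hFh.C_mul _, fun g₁ g₂ g₃ v => ?_, ?_⟩
  · rw [map_mul, map_mul, aeval_C, aeval_C, hFi g₁ g₂ g₃ v]
  · rw [map_mul, aeval_C, Algebra.algebraMap_self_apply, inv_mul_cancel₀ hFw]

end Scaling

/-! ### Cor. 5.12 from Thm. 5.11, Thm. 5.8(3) and `e(w) = m a(w) e'(w)` -/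

section Cor512

/-- **BI 2017, Cor. 5.12(1), conditional bridge**: "`\overline{Gw}` is not normal if
`a(w) < √m`" — from Thm. 5.11 (`m ≤ (a(w)e'(w))²`, so `a(w)² < m` forces `e'(w) ≥ 2`), Lemma 5.1(3)
(`e(w) = m a(w) e'(w) > m a(w)`) and Thm. 5.8(3) (then `\overline{Gw}` is not normal), exactly as the
paper's "The following is immediate" (L2224). [cite: BurgisserIkenmeyer2017, Cor. 5.12(1)] -/
theorem BI2017_cor_5_12_part1_of_facts (h511 : BI2017_thm_5_11) (h58 : BI2017_thm_5_8)
    (h513 : BI2017_lem_5_1_3) :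
    ∀ (m : ℕ) (w : Fin m → Fin m → Fin m → ℂ), 2 < m → w ≠ 0 → IsPolystableTensor w →
      0 < tensorStabilizerPeriod w → tensorStabilizerPeriod w ^ 2 < m →
      ¬ IsIntegrallyClosed (TensorOrbitCoordRing w) := by
  intro m w hm hw hps ha ham
  -- Thm. 5.11: `m ≤ (a e')²`, hence `a < a e'` and `1 < e'`
  have hlt : tensorStabilizerPeriod w < tensorStabilizerPeriod w * tensorMinimalExponent w :=
    lt_of_pow_lt_pow_left₀ 2 (Nat.zero_le _) (lt_of_lt_of_le ham (h511.1 m w hm hw hps))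
  have he' : 1 < tensorMinimalExponent w := by
    by_contra h
    have h' := Nat.mul_le_mul_left (tensorStabilizerPeriod w) (not_lt.1 h)
    rw [mul_one] at h'
    exact absurd hlt (not_lt.2 h')
  -- Lemma 5.1(3): `e(w) = m a e' > m a`
  have hma : 0 < m * tensorStabilizerPeriod w := Nat.mul_pos (by omega) ha
  have hed : m * tensorStabilizerPeriod w < tensorMinimalDegree w := by
    rw [(h513 m w hw hps).2]; exact lt_mul_of_one_lt_right hma he'
  -- the fundamental invariant exists (`e(w) > 0`) and Thm. 5.8(3) applies
  obtain ⟨Φ, hΦ⟩ := exists_isTensorFundamentalInvariant w ((Nat.zero_le _).trans_lt hed)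
  exact ((h58 m w Φ hw hps hΦ).2 hed).2

/-- **BI 2017, Cor. 5.12, conditional bridge** from Thm. 5.11, Thm. 5.8, Lemma 5.1(3) (part 1) and,
for part 2 ("Let `m ≥ 3`. Then `\overline{Gw}` is not normal for almost all `w ∈ ⊗³ℂ^m`"), the
generic period `a(m) = 1` (Thm. 4.2) and generic polystability (Prop. 4.10): off the zero set of
`F₁ F₂ X_{000}` (`F₁`, `F₂` the two genericity polynomials) a tensor is nonzero, polystable, of
period `1 < √m`, and part 1 applies. [cite: BurgisserIkenmeyer2017, Cor. 5.12] -/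
theorem BI2017_cor_5_12_of_facts (h511 : BI2017_thm_5_11) (h58 : BI2017_thm_5_8)
    (h513 : BI2017_lem_5_1_3) (h42 : BI2017_thm_4_2) (h410 : BI2017_prop_4_10) :
    BI2017_cor_5_12 := by
  have part1 := BI2017_cor_5_12_part1_of_facts h511 h58 h513
  refine ⟨part1, fun m hm => ?_⟩
  obtain ⟨F₁, hF₁, hP₁⟩ := h42.1 m hm
  obtain ⟨F₂, hF₂, hP₂⟩ := h410 m
  obtain ⟨i₀⟩ : Nonempty (Fin m) := ⟨⟨0, by omega⟩⟩
  refine ⟨F₁ * F₂ * X (i₀, i₀, i₀), mul_ne_zero (mul_ne_zero hF₁ hF₂) (X_ne_zero _),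
    fun w hw => ?_⟩
  rw [map_mul, map_mul, aeval_X] at hw
  have h1 : aeval (tensorPt w) F₁ ≠ 0 := fun h => hw (by rw [h, zero_mul, zero_mul])
  have h2 : aeval (tensorPt w) F₂ ≠ 0 := fun h => hw (by rw [h, mul_zero, zero_mul])
  have h3 : w i₀ i₀ i₀ ≠ 0 := fun h => hw (by rw [show tensorPt w (i₀, i₀, i₀) = w i₀ i₀ i₀ from rfl,
    h, mul_zero])
  have hw0 : w ≠ 0 := fun h => h3 (by rw [h]; rfl)
  have ha : tensorStabilizerPeriod w = 1 := hP₁ w h1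
  exact part1 m w (by omega) hw0 (hP₂ w h2) (by rw [ha]; exact one_pos) (by rw [ha]; omega)

end Cor512

/-! ### Relabelling the three index sets: `a(w)`, polystability and `O(\overline{Gw})` are invariant -/

section Relabel

variable {ι κ : Type*} [Fintype ι] [DecidableEq ι] [Fintype κ] [DecidableEq κ]
  (e₁ e₂ e₃ : ι ≃ κ)

omit [DecidableEq ι] [DecidableEq κ] in
/-- The `GL³`-action commutes with relabelling the index sets along bijections `eᵢ : ι ≃ κ`:
reading `(A ⊗ B ⊗ C)·wᵉ` (`wᵉ_{abc} = w_{e₁⁻¹a, e₂⁻¹b, e₃⁻¹c}`) back in the old labels gives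
`(Aᵉ ⊗ Bᵉ ⊗ Cᵉ)·w` with `Aᵉ = reindex e₁⁻¹ e₁⁻¹ A`. [folklore] -/
private theorem actTensor_relabel (A B C : Matrix κ κ ℂ) (w : ι → ι → ι → ℂ) :
    (fun x y z => actTensor A B C (fun a b c => w (e₁.symm a) (e₂.symm b) (e₃.symm c))
        (e₁ x) (e₂ y) (e₃ z)) =
      actTensor (reindex e₁.symm e₁.symm A) (reindex e₂.symm e₂.symm B)
        (reindex e₃.symm e₃.symm C) w := by
  funext x y z
  simp only [actTensor_apply, Matrix.reindex_apply, Matrix.submatrix_apply, Equiv.symm_symm]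
  refine Fintype.sum_equiv e₁.symm _ _ fun a => ?_
  refine Fintype.sum_equiv e₂.symm _ _ fun b => ?_
  refine Fintype.sum_equiv e₃.symm _ _ fun c => ?_
  simp only [Equiv.apply_symm_apply]

omit [Fintype ι] [DecidableEq ι] [Fintype κ] [DecidableEq κ] in
/-- Reading back in the old labels is injective. [folklore] -/
private theorem unrelabel_injective {v v' : κ → κ → κ → ℂ}
    (h : (fun x y z => v (e₁ x) (e₂ y) (e₃ z)) = fun x y z => v' (e₁ x) (e₂ y) (e₃ z)) :
    v = v' := by
  funext a b c
  have h' := congr_fun (congr_fun (congr_fun h (e₁.symm a)) (e₂.symm b)) (e₃.symm c)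
  simpa only [Equiv.apply_symm_apply] using h'

omit [Fintype ι] [DecidableEq ι] [Fintype κ] [DecidableEq κ] in
/-- `reindex e⁻¹ e⁻¹ ∘ reindex e e = id`. [folklore] -/
private theorem reindex_symm_reindex (e : ι ≃ κ) (M : Matrix ι ι ℂ) :
    reindex e.symm e.symm (reindex e e M) = M := by
  ext i j
  simp only [Matrix.reindex_apply, Matrix.submatrix_apply, Equiv.symm_symm,
    Equiv.symm_apply_apply]

/-- **Polystability is invariant under relabelling** the three index sets (the `SL³`-orbit of
`wᵉ` is the image of that of `w` under the linear homeomorphism `v ↦ vᵉ`).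
[cite: BurgisserIkenmeyer2017, §4.2 (polystable tensors)] -/
theorem IsPolystableTensor.relabel {w : ι → ι → ι → ℂ} (hw : IsPolystableTensor w) :
    IsPolystableTensor fun a b c => w (e₁.symm a) (e₂.symm b) (e₃.symm c) := by
  unfold IsPolystableTensor at hw ⊢
  -- reading back in the old labels, `g : ⊗³ℂ^κ → ⊗³ℂ^ι`, is continuous
  have hg : Continuous fun (v : κ → κ → κ → ℂ) (x y z : ι) => v (e₁ x) (e₂ y) (e₃ z) :=
    continuous_pi fun x => continuous_pi fun y => continuous_pi fun z =>
      (continuous_apply (e₃ z)).comp ((continuous_apply (e₂ y)).comp (continuous_apply (e₁ x)))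
  convert hw.preimage hg using 1
  ext v
  simp only [Set.mem_range, Set.mem_preimage]
  constructor
  · rintro ⟨s, rfl⟩
    refine ⟨⟨⟨reindex e₁.symm e₁.symm (s.1 : Matrix κ κ ℂ), ?_⟩,
      ⟨reindex e₂.symm e₂.symm (s.2.1 : Matrix κ κ ℂ), ?_⟩,
      ⟨reindex e₃.symm e₃.symm (s.2.2 : Matrix κ κ ℂ), ?_⟩⟩, ?_⟩
    · rw [det_reindex_self]; exact Matrix.SpecialLinearGroup.det_coe _
    · rw [det_reindex_self]; exact Matrix.SpecialLinearGroup.det_coe _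
    · rw [det_reindex_self]; exact Matrix.SpecialLinearGroup.det_coe _
    · exact (actTensor_relabel e₁ e₂ e₃ _ _ _ w).symm
  · rintro ⟨t, ht⟩
    refine ⟨⟨⟨reindex e₁ e₁ (t.1 : Matrix ι ι ℂ), ?_⟩, ⟨reindex e₂ e₂ (t.2.1 : Matrix ι ι ℂ), ?_⟩,
      ⟨reindex e₃ e₃ (t.2.2 : Matrix ι ι ℂ), ?_⟩⟩, ?_⟩
    · rw [det_reindex_self]; exact Matrix.SpecialLinearGroup.det_coe _
    · rw [det_reindex_self]; exact Matrix.SpecialLinearGroup.det_coe _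
    · rw [det_reindex_self]; exact Matrix.SpecialLinearGroup.det_coe _
    · apply unrelabel_injective e₁ e₂ e₃
      rw [actTensor_relabel e₁ e₂ e₃ _ _ _ w]
      simpa only [Matrix.SpecialLinearGroup.coe_mk, reindex_symm_reindex] using ht

/-- Relabelling on `GL`: the unit `g ↦ reindex e⁻¹ e⁻¹ g` of `Units.mapEquiv` along the ring
isomorphism `reindexRingEquiv`. [folklore] -/
private theorem coe_unitsMapEquiv_reindex (e : ι ≃ κ) (u : GL κ ℂ) :
    ((Units.mapEquiv (Matrix.reindexRingEquiv ℂ e.symm).toMulEquiv u : GL ι ℂ) : Matrix ι ι ℂ) =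
      reindex e.symm e.symm (u : Matrix κ κ ℂ) :=
  rfl

/-- **The stabilizer period is invariant under relabelling**: `χ(stab(wᵉ)) = χ(stab(w))` as
subsets of `ℂ^×` (relabelling conjugates the stabilizers inside `GL³` and preserves the three
determinants). [cite: BurgisserIkenmeyer2017, Def. 4.1] -/
theorem tensorStabChiImage_relabel (w : ι → ι → ι → ℂ) :
    tensorStabChiImage (fun a b c => w (e₁.symm a) (e₂.symm b) (e₃.symm c)) =
      tensorStabChiImage w := by
  -- the three relabelling isomorphisms `GL κ ≃* GL ι`
  set φ₁ := Units.mapEquiv (Matrix.reindexRingEquiv ℂ e₁.symm).toMulEquiv with hφ₁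
  set φ₂ := Units.mapEquiv (Matrix.reindexRingEquiv ℂ e₂.symm).toMulEquiv with hφ₂
  set φ₃ := Units.mapEquiv (Matrix.reindexRingEquiv ℂ e₃.symm).toMulEquiv with hφ₃
  have hstab : ∀ s : GL κ ℂ × GL κ ℂ × GL κ ℂ,
      s ∈ tensorStab (fun a b c => w (e₁.symm a) (e₂.symm b) (e₃.symm c)) ↔
        (φ₁ s.1, φ₂ s.2.1, φ₃ s.2.2) ∈ tensorStab w := by
    intro s
    rw [mem_tensorStab_iff, mem_tensorStab_iff]
    change _ ↔ actTensor (reindex e₁.symm e₁.symm (s.1 : Matrix κ κ ℂ))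
      (reindex e₂.symm e₂.symm (s.2.1 : Matrix κ κ ℂ)) (reindex e₃.symm e₃.symm (s.2.2 : Matrix κ κ ℂ))
      w = w
    rw [← actTensor_relabel e₁ e₂ e₃]
    constructor
    · intro h
      rw [h]
      funext x y z
      simp only [Equiv.symm_apply_apply]
    · intro h
      apply unrelabel_injective e₁ e₂ e₃
      rw [h]
      funext x y z
      simp only [Equiv.symm_apply_apply]
  have hchi : ∀ s : GL κ ℂ × GL κ ℂ × GL κ ℂ, tensorChi (φ₁ s.1, φ₂ s.2.1, φ₃ s.2.2) = tensorChi s := by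
    intro s
    ext
    simp only [tensorChi, Units.val_mul, Matrix.GeneralLinearGroup.val_det_apply, hφ₁, hφ₂, hφ₃,
      coe_unitsMapEquiv_reindex, Matrix.det_reindex_self]
  ext u
  simp only [tensorStabChiImage, Set.mem_image]
  constructor
  · rintro ⟨s, hs, rfl⟩
    exact ⟨_, (hstab s).1 hs, hchi s⟩
  · rintro ⟨t, ht, rfl⟩
    refine ⟨(φ₁.symm t.1, φ₂.symm t.2.1, φ₃.symm t.2.2), ?_, ?_⟩
    · rw [hstab]
      simpa only [MulEquiv.apply_symm_apply, Prod.mk.eta] using ht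
    · rw [← hchi]
      simp only [MulEquiv.apply_symm_apply, Prod.mk.eta]

/-- `a(wᵉ) = a(w)`. [cite: BurgisserIkenmeyer2017, Def. 4.1] -/
theorem tensorStabilizerPeriod_relabel (w : ι → ι → ι → ℂ) :
    tensorStabilizerPeriod (fun a b c => w (e₁.symm a) (e₂.symm b) (e₃.symm c)) =
      tensorStabilizerPeriod w := by
  unfold tensorStabilizerPeriod
  rw [tensorStabChiImage_relabel]

/-- The `GL³`-orbit of the relabelled tensor is the relabelled orbit: `G·wᵉ = (G·w)ᵉ`.
[cite: BurgisserIkenmeyer2017, §5 (the orbit `Gw`)] -/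
theorem tensorGLOrbit_relabel (w : ι → ι → ι → ℂ) :
    tensorGLOrbit (fun a b c => w (e₁.symm a) (e₂.symm b) (e₃.symm c)) =
      (fun v : ι → ι → ι → ℂ => fun a b c => v (e₁.symm a) (e₂.symm b) (e₃.symm c)) ''
        tensorGLOrbit w := by
  set φ₁ := Units.mapEquiv (Matrix.reindexRingEquiv ℂ e₁.symm).toMulEquiv with hφ₁
  set φ₂ := Units.mapEquiv (Matrix.reindexRingEquiv ℂ e₂.symm).toMulEquiv with hφ₂
  set φ₃ := Units.mapEquiv (Matrix.reindexRingEquiv ℂ e₃.symm).toMulEquiv with hφ₃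
  ext v
  simp only [tensorGLOrbit, Set.mem_setOf_eq, Set.mem_image]
  constructor
  · rintro ⟨s, rfl⟩
    refine ⟨_, ⟨(φ₁ s.1, φ₂ s.2.1, φ₃ s.2.2), rfl⟩, ?_⟩
    apply unrelabel_injective e₁ e₂ e₃
    rw [actTensor_relabel e₁ e₂ e₃ _ _ _ w]
    funext x y z
    simp only [Equiv.symm_apply_apply, hφ₁, hφ₂, hφ₃, coe_unitsMapEquiv_reindex]
  · rintro ⟨_, ⟨t, rfl⟩, rfl⟩
    refine ⟨(φ₁.symm t.1, φ₂.symm t.2.1, φ₃.symm t.2.2), ?_⟩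
    apply unrelabel_injective e₁ e₂ e₃
    rw [actTensor_relabel e₁ e₂ e₃ _ _ _ w]
    have h1 : reindex e₁.symm e₁.symm ((φ₁.symm t.1 : GL κ ℂ) : Matrix κ κ ℂ) = (t.1 : Matrix ι ι ℂ) := by
      rw [hφ₁, ← coe_unitsMapEquiv_reindex, MulEquiv.apply_symm_apply]
    have h2 : reindex e₂.symm e₂.symm ((φ₂.symm t.2.1 : GL κ ℂ) : Matrix κ κ ℂ) =
        (t.2.1 : Matrix ι ι ℂ) := by
      rw [hφ₂, ← coe_unitsMapEquiv_reindex, MulEquiv.apply_symm_apply]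
    have h3 : reindex e₃.symm e₃.symm ((φ₃.symm t.2.2 : GL κ ℂ) : Matrix κ κ ℂ) =
        (t.2.2 : Matrix ι ι ℂ) := by
      rw [hφ₃, ← coe_unitsMapEquiv_reindex, MulEquiv.apply_symm_apply]
    funext x y z
    simp only [Equiv.symm_apply_apply, h1, h2, h3]

/-- The vanishing ideal of the relabelled orbit is the relabelled vanishing ideal:
`I(G·wᵉ) = rename_ε(I(G·w))` for `ε = e₁ × e₂ × e₃` on the coordinates of `⊗³`.
[cite: BurgisserIkenmeyer2017, §5 (the coordinate ring `O(\overline{Gw})`)] -/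
theorem tensorOrbitVanishingIdeal_relabel (w : ι → ι → ι → ℂ) :
    tensorOrbitVanishingIdeal (fun a b c => w (e₁.symm a) (e₂.symm b) (e₃.symm c)) =
      (tensorOrbitVanishingIdeal w).map
        ((renameEquiv ℂ (e₁.prodCongr (e₂.prodCongr e₃))).toRingEquiv :
          MvPolynomial (ι × ι × ι) ℂ →+* MvPolynomial (κ × κ × κ) ℂ) := by
  rw [Ideal.map_comap_of_equiv]
  ext F
  rw [Ideal.mem_comap, tensorOrbitVanishingIdeal, tensorOrbitVanishingIdeal,
    MvPolynomial.mem_vanishingIdeal_iff, MvPolynomial.mem_vanishingIdeal_iff,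
    tensorGLOrbit_relabel]
  simp only [Set.forall_mem_image]
  refine forall₂_congr fun v _ => ?_
  rw [show tensorPt (fun a b c => v (e₁.symm a) (e₂.symm b) (e₃.symm c)) =
      tensorPt v ∘ (e₁.prodCongr (e₂.prodCongr e₃)).symm from rfl, ← aeval_rename]
  rfl

/-- **The coordinate rings of the orbit closures of `w` and of its relabelling `wᵉ` are
isomorphic** (`rename_ε` induces `O(\overline{Gw}) ≃ O(\overline{G wᵉ})`).
[cite: BurgisserIkenmeyer2017, §5 (the coordinate ring `O(\overline{Gw})`)] -/
theorem nonempty_ringEquiv_tensorOrbitCoordRing_relabel (w : ι → ι → ι → ℂ) :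
    Nonempty (TensorOrbitCoordRing w ≃+*
      TensorOrbitCoordRing (fun a b c => w (e₁.symm a) (e₂.symm b) (e₃.symm c))) :=
  ⟨Ideal.quotientEquiv _ _ (renameEquiv ℂ (e₁.prodCongr (e₂.prodCongr e₃))).toRingEquiv
    (tensorOrbitVanishingIdeal_relabel e₁ e₂ e₃ w)⟩

/-- Normality of the orbit closure is invariant under relabelling.
[cite: BurgisserIkenmeyer2017, §5 (the coordinate ring `O(\overline{Gw})`)] -/
theorem isIntegrallyClosed_tensorOrbitCoordRing_relabel_iff (w : ι → ι → ι → ℂ) :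
    IsIntegrallyClosed (TensorOrbitCoordRing fun a b c => w (e₁.symm a) (e₂.symm b) (e₃.symm c)) ↔
      IsIntegrallyClosed (TensorOrbitCoordRing w) := by
  obtain ⟨f⟩ := nonempty_ringEquiv_tensorOrbitCoordRing_relabel e₁ e₂ e₃ w
  exact ⟨fun _ => IsIntegrallyClosed.of_equiv f.symm, fun _ => IsIntegrallyClosed.of_equiv f⟩

end Relabel

/-! ### `⟨n,n,n⟩` in its three formats, and Cor. 5.26 -/

section Cor526

/-- `⟨n,n,n⟩ ∈ ⊗³ℂ^{n²}` (`biMatMulTensorFin`) is the relabelling of `⟨n,n,n⟩ ∈ ⊗³ℂ^{n×n}`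
(`biMatMulTensor`) along `finProdFinEquiv` in each factor. [cite: BurgisserIkenmeyer2017, Prop. 5.24] -/
theorem biMatMulTensorFin_eq_relabel (n : ℕ) :
    biMatMulTensorFin n ℂ = fun a b c => biMatMulTensor ℂ n (finProdFinEquiv.symm a)
      (finProdFinEquiv.symm b) (finProdFinEquiv.symm c) :=
  rfl

/-- BI's `⟨n,n,n⟩ ∈ ⊗³ℂ^{n×n}` is the relabelling of the tree's `matMulTensor ℂ n n n` (Bläser's
coordinates) along the swap of the first index pair. [cite: BurgisserIkenmeyer2017, §4.1 (before Thm. 4.5)] -/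
theorem biMatMulTensor_eq_relabel_matMulTensor (n : ℕ) :
    biMatMulTensor ℂ n = fun a b c => matMulTensor ℂ n n n
      ((Equiv.prodComm (Fin n) (Fin n)).symm a) ((Equiv.refl (Fin n × Fin n)).symm b)
      ((Equiv.refl (Fin n × Fin n)).symm c) := by
  funext a b c
  rw [biMatMulTensor_apply_eq]
  rfl

/-- `⟨n,n,n⟩ ∈ ⊗³ℂ^{n×n}` is polystable (Cor. 4.9, from the tree's discharged
`BurgisserIkenmeyer2017_cor49_matMulTensor_holds` by relabelling). [cite: BurgisserIkenmeyer2017, Cor. 4.9] -/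
theorem isPolystableTensor_biMatMulTensor (n : ℕ) : IsPolystableTensor (biMatMulTensor ℂ n) := by
  rw [biMatMulTensor_eq_relabel_matMulTensor]
  exact (BurgisserIkenmeyer2017_cor49_matMulTensor_iff.mp
    BurgisserIkenmeyer2017_cor49_matMulTensor_holds n).relabel _ _ _

/-- `⟨n,n,n⟩ ∈ ⊗³ℂ^{n²}` is polystable. [cite: BurgisserIkenmeyer2017, Cor. 4.9] -/
theorem isPolystableTensor_biMatMulTensorFin (n : ℕ) : IsPolystableTensor (biMatMulTensorFin n ℂ) := by
  rw [biMatMulTensorFin_eq_relabel]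
  exact (isPolystableTensor_biMatMulTensor n).relabel _ _ _

/-- `a(⟨n,n,n⟩) = 1` in the format `⊗³ℂ^{n²}` (Cor. 4.6, proved in the tree as
`BI2017_cor_4_6_holds`, transported). [cite: BurgisserIkenmeyer2017, Cor. 4.6] -/
theorem tensorStabilizerPeriod_biMatMulTensorFin (n : ℕ) :
    tensorStabilizerPeriod (biMatMulTensorFin n ℂ) = 1 := by
  rw [biMatMulTensorFin_eq_relabel, tensorStabilizerPeriod_relabel]
  exact BI2017_cor_4_6_holds n

/-- `⟨n,n,n⟩ ≠ 0` for `n ≥ 1`. [cite: BurgisserIkenmeyer2017, §4.1 (before Thm. 4.5)] -/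
theorem biMatMulTensorFin_ne_zero (n : ℕ) (hn : 1 ≤ n) : biMatMulTensorFin n ℂ ≠ 0 := by
  intro h
  have h' := congr_fun (congr_fun (congr_fun h (finProdFinEquiv (⟨0, hn⟩, ⟨0, hn⟩)))
    (finProdFinEquiv (⟨0, hn⟩, ⟨0, hn⟩))) (finProdFinEquiv (⟨0, hn⟩, ⟨0, hn⟩))
  simp [biMatMulTensorFin, biMatMulTensor] at h'

/-- Normality of the orbit closure of `⟨n,n,n⟩` does not depend on the format (`⊗³ℂ^{n×n}`
versus `⊗³ℂ^{n²}`). [cite: BurgisserIkenmeyer2017, Cor. 5.26] -/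
theorem isIntegrallyClosed_tensorOrbitCoordRing_biMatMulTensorFin_iff (n : ℕ) :
    IsIntegrallyClosed (TensorOrbitCoordRing (biMatMulTensorFin n ℂ)) ↔
      IsIntegrallyClosed (TensorOrbitCoordRing (biMatMulTensor ℂ n)) := by
  rw [biMatMulTensorFin_eq_relabel]
  exact isIntegrallyClosed_tensorOrbitCoordRing_relabel_iff _ _ _ (biMatMulTensor ℂ n)

/-- **BI 2017, Cor. 5.26, first sentence, from Cor. 5.12(1)**: "The orbit closure of the unit
tensor `⟨m⟩` is not normal if `m ≥ 5`" — `⟨m⟩ ≠ 0` is polystable (Cor. 4.9, proved) of period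
`a(⟨m⟩) = 2` (Thm. 4.3, proved) and `2² < m`. [cite: BurgisserIkenmeyer2017, Cor. 5.26] -/
theorem BI2017_cor_5_26_unitTensor_of_cor_5_12_part1
    (h1 : ∀ (m : ℕ) (w : Fin m → Fin m → Fin m → ℂ), 2 < m → w ≠ 0 → IsPolystableTensor w →
      0 < tensorStabilizerPeriod w → tensorStabilizerPeriod w ^ 2 < m →
      ¬ IsIntegrallyClosed (TensorOrbitCoordRing w))
    (m : ℕ) (hm : 5 ≤ m) : ¬ IsIntegrallyClosed (TensorOrbitCoordRing (unitTensor ℂ m)) := by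
  have ha : tensorStabilizerPeriod (unitTensor ℂ m) = 2 := (BI2017_thm_4_3_holds m).2 (by omega)
  obtain ⟨i₀⟩ : Nonempty (Fin m) := ⟨⟨0, by omega⟩⟩
  have hne : unitTensor ℂ m ≠ 0 := fun h => by
    have h' := congr_fun (congr_fun (congr_fun h i₀) i₀) i₀
    simp [unitTensor_apply] at h'
  exact h1 m _ (by omega) hne (BI2017_cor_4_9_unitTensor_holds m) (by rw [ha]; exact two_pos)
    (by rw [ha]; omega)

/-- **BI 2017, Cor. 5.26, second sentence, from Cor. 5.12(1)**: "The orbit closure of the matrix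
multiplication tensor `⟨n,n,n⟩` is not normal if `n ≥ 2`" — in the format `⊗³ℂ^{n²}`, `⟨n,n,n⟩ ≠ 0`
is polystable (Cor. 4.9) of period `a = 1` (Cor. 4.6) and `1² < n²`; then transport back to
`⊗³ℂ^{n×n}`. [cite: BurgisserIkenmeyer2017, Cor. 5.26] -/
theorem BI2017_cor_5_26_biMatMulTensor_of_cor_5_12_part1
    (h1 : ∀ (m : ℕ) (w : Fin m → Fin m → Fin m → ℂ), 2 < m → w ≠ 0 → IsPolystableTensor w →
      0 < tensorStabilizerPeriod w → tensorStabilizerPeriod w ^ 2 < m →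
      ¬ IsIntegrallyClosed (TensorOrbitCoordRing w))
    (n : ℕ) (hn : 2 ≤ n) : ¬ IsIntegrallyClosed (TensorOrbitCoordRing (biMatMulTensor ℂ n)) := by
  have h4 : 2 * 2 ≤ n * n := Nat.mul_le_mul hn hn
  rw [← isIntegrallyClosed_tensorOrbitCoordRing_biMatMulTensorFin_iff]
  exact h1 (n * n) (biMatMulTensorFin n ℂ) (by omega) (biMatMulTensorFin_ne_zero n (by omega))
    (isPolystableTensor_biMatMulTensorFin n)
    (by rw [tensorStabilizerPeriod_biMatMulTensorFin]; exact one_pos)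
    (by rw [tensorStabilizerPeriod_biMatMulTensorFin]; omega)

/-- **BI 2017, Cor. 5.26 from Cor. 5.12** ("Theorem 5.11 immediately implies the following",
L2494, via Cor. 5.12(1) with `a(⟨m⟩) = 2`, `a(⟨n,n,n⟩) = 1`). [cite: BurgisserIkenmeyer2017, Cor. 5.26] -/
theorem BI2017_cor_5_26_of_cor_5_12 (h512 : BI2017_cor_5_12) : BI2017_cor_5_26 :=
  ⟨BI2017_cor_5_26_unitTensor_of_cor_5_12_part1 h512.1,
    BI2017_cor_5_26_biMatMulTensor_of_cor_5_12_part1 h512.1⟩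

/-- **BI 2017, Cor. 5.26, conditional bridge** from Thm. 5.11, Thm. 5.8 and Lemma 5.1(3) (the
remaining inputs — Thm. 4.3, Cor. 4.6, Cor. 4.9 — are proved in the tree).
[cite: BurgisserIkenmeyer2017, Cor. 5.26] -/
theorem BI2017_cor_5_26_of_facts (h511 : BI2017_thm_5_11) (h58 : BI2017_thm_5_8)
    (h513 : BI2017_lem_5_1_3) : BI2017_cor_5_26 :=
  ⟨BI2017_cor_5_26_unitTensor_of_cor_5_12_part1 (BI2017_cor_5_12_part1_of_facts h511 h58 h513),
    BI2017_cor_5_26_biMatMulTensor_of_cor_5_12_part1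
      (BI2017_cor_5_12_part1_of_facts h511 h58 h513)⟩

end Cor526

/-! ### `GL³`-orbit invariance of the stabilizer period and of polystability

(Appended by the same seat.) `stab(g·w) = g stab(w) g⁻¹` and `χ` is a class function, so
`χ(stab(g·w)) = χ(stab(w))` and `a(g·w) = a(w)` (§4.1: the period is attached to orbits — "almost all
`w` have the stabilizer period `a(m)`"); and `SL³·(g·w) = g·(SL³·w)` (`SL³ ⊴ GL³`), so polystability
is a property of `GL³`-orbits (§4.2). -/

section OrbitInvariance

variable {ι : Type*} [Fintype ι] [DecidableEq ι]

/-- `(g ⊗ g' ⊗ g'')⁻¹·((g ⊗ g' ⊗ g'')·v) = v` for `g ∈ GL³`. [folklore] -/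
private theorem actTensor_inv_actTensor (g : GL ι ℂ × GL ι ℂ × GL ι ℂ) (v : ι → ι → ι → ℂ) :
    actTensor ((g.1⁻¹ : GL ι ℂ) : Matrix ι ι ℂ) ((g.2.1⁻¹ : GL ι ℂ) : Matrix ι ι ℂ)
        ((g.2.2⁻¹ : GL ι ℂ) : Matrix ι ι ℂ)
      (actTensor (g.1 : Matrix ι ι ℂ) (g.2.1 : Matrix ι ι ℂ) (g.2.2 : Matrix ι ι ℂ) v) = v := by
  rw [actTensor_actTensor, Units.inv_mul, Units.inv_mul, Units.inv_mul, actTensor_one]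

/-- `(g ⊗ g' ⊗ g'')·((g ⊗ g' ⊗ g'')⁻¹·v) = v` for `g ∈ GL³`. [folklore] -/
private theorem actTensor_actTensor_inv (g : GL ι ℂ × GL ι ℂ × GL ι ℂ) (v : ι → ι → ι → ℂ) :
    actTensor (g.1 : Matrix ι ι ℂ) (g.2.1 : Matrix ι ι ℂ) (g.2.2 : Matrix ι ι ℂ)
      (actTensor ((g.1⁻¹ : GL ι ℂ) : Matrix ι ι ℂ) ((g.2.1⁻¹ : GL ι ℂ) : Matrix ι ι ℂ)
        ((g.2.2⁻¹ : GL ι ℂ) : Matrix ι ι ℂ) v) = v := by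
  rw [actTensor_actTensor, Units.mul_inv, Units.mul_inv, Units.mul_inv, actTensor_one]

/-- **`stab(g·w) = g stab(w) g⁻¹`**: `s ∈ stab(g·w) ⟺ g⁻¹ s g ∈ stab(w)`.
[cite: BurgisserIkenmeyer2017, §4.1 eq. (4.1)] -/
theorem mem_tensorStab_actTensor_iff (g s : GL ι ℂ × GL ι ℂ × GL ι ℂ) (w : ι → ι → ι → ℂ) :
    s ∈ tensorStab (actTensor (g.1 : Matrix ι ι ℂ) (g.2.1 : Matrix ι ι ℂ) (g.2.2 : Matrix ι ι ℂ) w) ↔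
      g⁻¹ * s * g ∈ tensorStab w := by
  rw [mem_tensorStab_iff, mem_tensorStab_iff]
  simp only [Prod.fst_mul, Prod.snd_mul, Prod.fst_inv, Prod.snd_inv, Units.val_mul, mul_assoc,
    ← actTensor_actTensor]
  constructor
  · intro h
    rw [h]
    exact actTensor_inv_actTensor g w
  · intro h
    have h' := congrArg (actTensor (g.1 : Matrix ι ι ℂ) (g.2.1 : Matrix ι ι ℂ) (g.2.2 : Matrix ι ι ℂ)) h
    rwa [actTensor_actTensor_inv] at h'

/-- `χ` is a class function: `χ(g⁻¹ s g) = χ(s)`. [cite: BurgisserIkenmeyer2017, §4.1 eq. (4.2)] -/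
theorem tensorChi_conj (g s : GL ι ℂ × GL ι ℂ × GL ι ℂ) : tensorChi (g⁻¹ * s * g) = tensorChi s := by
  simp only [tensorChi, Prod.fst_mul, Prod.snd_mul, Prod.fst_inv, Prod.snd_inv, map_mul, map_inv,
    inv_mul_cancel_comm]

/-- **`χ(stab(g·w)) = χ(stab(w))`**: the image `H = χ(stab(w))` depends only on the `GL³`-orbit.
[cite: BurgisserIkenmeyer2017, §4.1] -/
theorem tensorStabChiImage_actTensor (g : GL ι ℂ × GL ι ℂ × GL ι ℂ) (w : ι → ι → ι → ℂ) :
    tensorStabChiImage (actTensor (g.1 : Matrix ι ι ℂ) (g.2.1 : Matrix ι ι ℂ) (g.2.2 : Matrix ι ι ℂ) w) =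
      tensorStabChiImage w := by
  ext u
  simp only [tensorStabChiImage, Set.mem_image]
  constructor
  · rintro ⟨s, hs, rfl⟩
    exact ⟨g⁻¹ * s * g, (mem_tensorStab_actTensor_iff g s w).1 hs, tensorChi_conj g s⟩
  · rintro ⟨t, ht, rfl⟩
    refine ⟨g * t * g⁻¹, (mem_tensorStab_actTensor_iff g _ w).2 ?_, ?_⟩
    · simpa only [mul_assoc, inv_mul_cancel, mul_one, inv_mul_cancel_left] using ht
    · rw [← tensorChi_conj g (g * t * g⁻¹)]
      simp only [mul_assoc, inv_mul_cancel, mul_one, inv_mul_cancel_left]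

/-- **The stabilizer period is a `GL³`-orbit invariant**: `a(g·w) = a(w)`.
[cite: BurgisserIkenmeyer2017, Def. 4.1] -/
theorem tensorStabilizerPeriod_actTensor (g : GL ι ℂ × GL ι ℂ × GL ι ℂ) (w : ι → ι → ι → ℂ) :
    tensorStabilizerPeriod
        (actTensor (g.1 : Matrix ι ι ℂ) (g.2.1 : Matrix ι ι ℂ) (g.2.2 : Matrix ι ι ℂ) w) =
      tensorStabilizerPeriod w := by
  unfold tensorStabilizerPeriod
  rw [tensorStabChiImage_actTensor]

/-- Conjugating `SL³` inside `GL³`: `g⁻¹ s g ∈ SL` for `s ∈ SL`, `g ∈ GL` (as a matrix of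
determinant one). [folklore] -/
private theorem det_units_inv_mul_mul (g : GL ι ℂ) (S : Matrix ι ι ℂ) (hS : S.det = 1) :
    (((g⁻¹ : GL ι ℂ) : Matrix ι ι ℂ) * S * (g : Matrix ι ι ℂ)).det = 1 := by
  rw [Matrix.det_mul, Matrix.det_mul, hS, mul_one, ← Matrix.det_mul, Units.inv_mul, Matrix.det_one]

/-- Conjugating `SL³` inside `GL³`: `g s g⁻¹ ∈ SL` for `s ∈ SL`, `g ∈ GL`. [folklore] -/
private theorem det_units_mul_mul_inv (g : GL ι ℂ) (S : Matrix ι ι ℂ) (hS : S.det = 1) :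
    ((g : Matrix ι ι ℂ) * S * ((g⁻¹ : GL ι ℂ) : Matrix ι ι ℂ)).det = 1 := by
  rw [Matrix.det_mul, Matrix.det_mul, hS, mul_one, ← Matrix.det_mul, Units.mul_inv, Matrix.det_one]

/-- **Polystability is a property of `GL³`-orbits**: `SL³·(g·w) = g·(SL³·w)` (`SL³ ⊴ GL³`), the
image of a closed set under the linear homeomorphism `v ↦ g·v`.
[cite: BurgisserIkenmeyer2017, §4.2 (polystable tensors)] -/
theorem IsPolystableTensor.actTensor_gl {w : ι → ι → ι → ℂ} (hw : IsPolystableTensor w)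
    (g : GL ι ℂ × GL ι ℂ × GL ι ℂ) :
    IsPolystableTensor (actTensor (g.1 : Matrix ι ι ℂ) (g.2.1 : Matrix ι ι ℂ) (g.2.2 : Matrix ι ι ℂ) w) := by
  unfold IsPolystableTensor at hw ⊢
  convert hw.preimage (continuous_actTensor ((g.1⁻¹ : GL ι ℂ) : Matrix ι ι ℂ)
    ((g.2.1⁻¹ : GL ι ℂ) : Matrix ι ι ℂ) ((g.2.2⁻¹ : GL ι ℂ) : Matrix ι ι ℂ)) using 1
  ext v
  simp only [Set.mem_range, Set.mem_preimage]
  constructor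
  · rintro ⟨s, rfl⟩
    -- `g⁻¹ (s (g w)) = (g⁻¹ s g) w`
    refine ⟨⟨⟨((g.1⁻¹ : GL ι ℂ) : Matrix ι ι ℂ) * (s.1 : Matrix ι ι ℂ) * (g.1 : Matrix ι ι ℂ),
        det_units_inv_mul_mul g.1 _ (Matrix.SpecialLinearGroup.det_coe _)⟩,
      ⟨((g.2.1⁻¹ : GL ι ℂ) : Matrix ι ι ℂ) * (s.2.1 : Matrix ι ι ℂ) * (g.2.1 : Matrix ι ι ℂ),
        det_units_inv_mul_mul g.2.1 _ (Matrix.SpecialLinearGroup.det_coe _)⟩,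
      ⟨((g.2.2⁻¹ : GL ι ℂ) : Matrix ι ι ℂ) * (s.2.2 : Matrix ι ι ℂ) * (g.2.2 : Matrix ι ι ℂ),
        det_units_inv_mul_mul g.2.2 _ (Matrix.SpecialLinearGroup.det_coe _)⟩⟩, ?_⟩
    rw [actTensor_actTensor, actTensor_actTensor]
  · rintro ⟨t, ht⟩
    -- `t w = g⁻¹ v`, so `v = g (t w) = (g t g⁻¹) (g w)`
    refine ⟨⟨⟨(g.1 : Matrix ι ι ℂ) * (t.1 : Matrix ι ι ℂ) * ((g.1⁻¹ : GL ι ℂ) : Matrix ι ι ℂ),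
        det_units_mul_mul_inv g.1 _ (Matrix.SpecialLinearGroup.det_coe _)⟩,
      ⟨(g.2.1 : Matrix ι ι ℂ) * (t.2.1 : Matrix ι ι ℂ) * ((g.2.1⁻¹ : GL ι ℂ) : Matrix ι ι ℂ),
        det_units_mul_mul_inv g.2.1 _ (Matrix.SpecialLinearGroup.det_coe _)⟩,
      ⟨(g.2.2 : Matrix ι ι ℂ) * (t.2.2 : Matrix ι ι ℂ) * ((g.2.2⁻¹ : GL ι ℂ) : Matrix ι ι ℂ),
        det_units_mul_mul_inv g.2.2 _ (Matrix.SpecialLinearGroup.det_coe _)⟩⟩, ?_⟩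
    rw [actTensor_actTensor]
    simp only [Matrix.mul_assoc, Units.inv_mul, Matrix.mul_one]
    rw [← actTensor_actTensor, ht, actTensor_actTensor_inv]

end OrbitInvariance

end Literature.Computability.AlgebraicComplexity
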